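import Summits.QuantumFields.BalabanUV.T4Continuum.Support.MinimalActionRate
import Summits.QuantumFields.BalabanUV.T4Continuum.Support.AveragingDeficitMultiLevelPrep
import Summits.QuantumFields.BalabanUV.T4Continuum.Support.NE3HessForm
import HarnessLib

/-!
# NE7OpenOfApeIft — THE LETTER (OPEN) OF THE CONTINUITY METHOD SPLIT INTO ITS TWO FINAL SHAPES: the A-PRIORI ESTIMATE WITH MARGIN (APE) and the
# LOCAL CONTINUATION of a tangent-critical admissible configuration (IFT) — OPEN ⇐ APE ∧ IFT, by composition

Cell `pub-balaban`, rung (B)+1 sub-cell t4, lineage `b2b-balaban-t4-ne7-p1`, generation 67 (CRUX PROVER NE7 #1); hunt (h11), memo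
`t4/b2b-balaban-t4-ne7-p1-g67/HUNT-H11-NORMAL-CURRENCY.md` §3, §5.  File F24 (shapes only; consumed by F18 `critOneStep_tan_of_continuity`, F20
`oneStep_of_path_open_repW`, F23 `oneStep_of_sector_open_repW` as their `hopen`).

WHAT ([folklore]; 0 def, 0 sorry; one theorem).  **`open_of_ape_ift`** — at level `k+1` of `sfClass d L N ε`, along a data path `γ`, with two radii
`r₁` (the a-priori radius) and `r` (the working radius):
* (APE) «every admissible configuration for a datum `γ τ`, `τ ∈ [0,1]`, with `SmallField · r` that is critical on the tangent space `T(U) = {φ skew,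
  (N·L^{k+1})-periodic : TangentIter L k U φ}` has `SmallField · r₁`» — the A-PRIORI ESTIMATE ([Balaban1985Variational] Sect. F TYPE: «we will use only the
  fact that they are critical configurations», p. 300; in the dictionary `r = δη²`-type working radius inside the class radius `εη²`, `r₁ < r` the improved
  radius `B₃ε₁η²`-type; LOCAL-FLAT (i) of memo H10 §3bis is OUR intended proof);
* (IFT) «a tangent-critical admissible configuration with `SmallField · r₁` for the datum `γ τ₀` continues, for `|τ − τ₀| < ρ`, to tangent-critical
  admissible configurations with `SmallField · r` for the data `γ τ`» — the finite-dimensional implicit-function continuation on the gauge slice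
  (non-degeneracy = F1 `hess_vary_ge_of_poincare` + (P♮)_W + the multiplier letter with a SMOOTH preimage, memo §2(ii); the radius slack `r₁ → r` absorbs
  the continuity of the branch);
⟹ (OPEN) in the exact shape consumed by F18 ∕ F20 ∕ F23.
HONEST FRAMING (page 1).  A two-line composition fixing the SHAPES of the two remaining existence letters; both are HYPOTHESES asserted for nothing; NOT
OPEN, NOT CRIT-ONE-STEP, NOT NE7; spine 0∕9; finite T⁴ rung (B)+1 — NOT infinite volume, NOT mass gap, NOT Clay.  Continuum YM on T⁴ ⇐ BetaPertH ∧ nine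
spine estimates (0/9 proved); BetaPertH ⇐ (D1) ∧ (D4) ∧ CAP+tail; G-an2-4 gates asym, D1 and NE2/3/4.
-/

set_option autoImplicit false

open scoped BigOperators Matrix Matrix.Norms.L2Operator
open NormedSpace Finset Set

namespace Summit.QuantumFields.BalabanUV.T4Continuum.NE7OpenOfApeIft

open Literature.MathematicalPhysics.QuantumFieldTheory.Balaban1983to89
open B7Prop1Explicit B7Prop2Explicit
open T4AveragingDeficitWall (IsUnitaryCfg IsSkewDir SmallField)
open AveragingDeficitPeriodicCounting (IsPeriodicDir)
open AveragingDeficitMultiLevelPrep (TangentIter)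
open MinimalActionLevels (perWin)
open MinimalActionSandwich (admissible)
open MinimalActionRate (sfClass)
open NE3HessForm (dAction)

noncomputable section

variable {d : ℕ} {n : Type*} [Fintype n] [DecidableEq n]

/-- **(OPEN) ⇐ (APE) ∧ (IFT)**, by composition.  See the module docstring for the meaning and the intended proofs of the two letters. [folklore] -/
theorem open_of_ape_ift {L N k : ℕ} {ε r₁ r : ℝ} (γ : ℝ → (Site d → Fin d → (Matrix n n ℂ)ˣ))
    (hAPE : ∀ τ ∈ Icc (0 : ℝ) 1, ∀ U : Site d → Fin d → (Matrix n n ℂ)ˣ, U ∈ admissible (sfClass d L N ε) L (k + 1) (γ τ) → SmallField U r →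
      (∀ φ : Site d → Fin d → Matrix n n ℂ, IsSkewDir φ → IsPeriodicDir φ ((N * L ^ (k + 1) : ℕ) : ℤ) → TangentIter L k U φ →
        dAction U φ (perWin d (N * L ^ (k + 1))) = 0) →
      SmallField U r₁)
    (hIFT : ∀ τ₀ ∈ Icc (0 : ℝ) 1, ∀ U₀ : Site d → Fin d → (Matrix n n ℂ)ˣ, U₀ ∈ admissible (sfClass d L N ε) L (k + 1) (γ τ₀) → SmallField U₀ r₁ →
      (∀ φ : Site d → Fin d → Matrix n n ℂ, IsSkewDir φ → IsPeriodicDir φ ((N * L ^ (k + 1) : ℕ) : ℤ) → TangentIter L k U₀ φ →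
        dAction U₀ φ (perWin d (N * L ^ (k + 1))) = 0) →
      ∃ ρ : ℝ, 0 < ρ ∧ ∀ τ ∈ Icc (0 : ℝ) 1, |τ - τ₀| < ρ →
        ∃ U : Site d → Fin d → (Matrix n n ℂ)ˣ, U ∈ admissible (sfClass d L N ε) L (k + 1) (γ τ) ∧ SmallField U r ∧
          ∀ φ : Site d → Fin d → Matrix n n ℂ, IsSkewDir φ → IsPeriodicDir φ ((N * L ^ (k + 1) : ℕ) : ℤ) → TangentIter L k U φ →
            dAction U φ (perWin d (N * L ^ (k + 1))) = 0) :
    ∀ τ₀ ∈ Icc (0 : ℝ) 1,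
      (∃ U : Site d → Fin d → (Matrix n n ℂ)ˣ, U ∈ admissible (sfClass d L N ε) L (k + 1) (γ τ₀) ∧ SmallField U r ∧
        ∀ φ : Site d → Fin d → Matrix n n ℂ, IsSkewDir φ → IsPeriodicDir φ ((N * L ^ (k + 1) : ℕ) : ℤ) → TangentIter L k U φ →
          dAction U φ (perWin d (N * L ^ (k + 1))) = 0) →
      ∃ ρ : ℝ, 0 < ρ ∧ ∀ τ ∈ Icc (0 : ℝ) 1, |τ - τ₀| < ρ →
        ∃ U : Site d → Fin d → (Matrix n n ℂ)ˣ, U ∈ admissible (sfClass d L N ε) L (k + 1) (γ τ) ∧ SmallField U r ∧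
          ∀ φ : Site d → Fin d → Matrix n n ℂ, IsSkewDir φ → IsPeriodicDir φ ((N * L ^ (k + 1) : ℕ) : ℤ) → TangentIter L k U φ →
            dAction U φ (perWin d (N * L ^ (k + 1))) = 0 := by
  rintro τ₀ hτ₀ ⟨U, hU, hUr, hUc⟩
  exact hIFT τ₀ hτ₀ U hU (hAPE τ₀ hτ₀ U hU hUr hUc) hUc

end

end Summit.QuantumFields.BalabanUV.T4Continuum.NE7OpenOfApeIft
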